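import Mathlib.RingTheory.Filtration
import Mathlib.Algebra.CharP.Lemmas
import Mathlib.RingTheory.MvPolynomial.Homogeneous
import Mathlib.Algebra.MvPolynomial.Monad
import Mathlib.Algebra.Squarefree.Basic
import Mathlib.RingTheory.Polynomial.UniqueFactorization
import HarnessLib

/-!
# [OURS · L1 W4.5(b) · EL♮(3)] S7 — CONE-FORM CONSTANTS: infinitely root-divisible germs are constants (characteristic `p`), and the
# exactness of every `O`-lift of a constant-coefficient form (crux `EquisingularLiftNatThree` = stmt-ResolutionOfSingularities-20148)

res-type-100 g12, object S7 `hBaseKCL` (res-D-pv-029 TOWER₃ assembly; res-L1-w45b-plan-1 CHAIN v7.31 §1(1)). OURS; NOT a statement of any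
manuscript; AI-written, weaker than expert review; `--supports stmt-ResolutionOfSingularities-20148 --as helper`; closes nothing. Pure commutative
algebra, definition-free.

THE SETTING (abstracting the model square at the special point): a local Noetherian ring `A` (`= 𝒪_{F₁,x}`), a ring map `ρ : O → A`
(`= j^♯_x ∘ ι`, the constants) and `π : A → κ` with `ker π = 𝔪_A` (`= 𝒪_{F₁,x} → 𝒪_{F₁,x}/(c̄)`) such that `π ∘ ρ` is onto (the residue
model `π₀`) and `π (ρ r) = 0 ⇒ ρ r = 0` (`ρ` kills `𝔪_O`: the constants form a coefficient FIELD).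

* `eq_zero_of_forall_pow_of_mem_maximalIdeal` — an element of `𝔪_A` with `e`-th roots for every `e ≥ 1` is `0` (Krull).
* `exists_eq_of_forall_pow` — **in characteristic `p`**, an element of `A` with `e`-th roots for every `e ≥ 1` is a CONSTANT `ρ r`: write
  `a = b^{p^n}`, `b ≡ ρ μ (mod 𝔪)`; Frobenius is additive, so `a - ρ(μ^{p^n}) = (b - ρ μ)^{p^n} ∈ 𝔪^{p^n}`, and `ρ(μ^{p^n}) = ρ λ` for the
  constant `λ` with `ρ λ ≡ a` (two constants with the same residue are equal); hence `a - ρ λ ∈ ⋂ₙ 𝔪ⁿ = 0`. This is the argument of the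
  …NatTowerConeDefs docstring (res-L1-w45b-lead-2) made kernel-checked; it is where `ConeForm`'s «coefficients infinitely root-divisible»
  becomes «coefficients in `k`».
* `exists_map_eq_of_forall_coeff_pow` — hence a polynomial with root-divisible coefficients is `map ρ Φ` for some `Φ ∈ O[T]`.
* `map_eq_zero_of_map_comp_eq_zero` — `map (π ∘ ρ) P = 0 ⇒ map ρ P = 0`.
* `map_ne_zero_of_span_eval_ne_bot` — a root-divisible `φ` with `(φ(c)) ≠ 0` has `π_* φ ≠ 0`.
* `dvd_of_mem_radical_span_of_squarefree` — over a field, `ḡ` square-free and `φ̄ ∈ √(ḡ)` give `ḡ ∣ φ̄`.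
* `span_eval_map_eq_of_reduction` — **EXACTNESS OF THE LIFTED CONE.** If `φ` has root-divisible coefficients, `(φ(c))` is a radical ideal,
  and `Φ₀ ∈ O[T]` reduces to a `ḡ` with `ḡ ∣ φ̄` and `ḡ ∈ √(φ̄)` (T-TCONE's square-free reduction relations), then `((ρ_*Φ₀)(c)) = (φ(c))`:
  every relation modulo `𝔪` between constant-coefficient polynomials LIFTS EXACTLY (`φ = ρ_*Φ₀ · ρ_*H`, `(ρ_*Φ₀)^M = φ · ρ_*E`).
  Consequence (…NatTCPlusMemberKCLUncentred): the B-series cone `K₀` (germ `ι_*Φ₀(c)`) has `(K₀·𝒪_{F₁})_x = 𝓘⟨closure W⟩_x` as soon as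
  the section frame lifts the `ConeForm` frame — the (vii-loc) germ identity.

References: H. Matsumura, *Commutative Ring Theory* (1986), Thm. 8.10 (Krull's intersection theorem); N. Bourbaki, *Algèbre* V §1
(Frobenius additivity); O. Zariski, P. Samuel, *Commutative Algebra* II (1960), Ch. VIII §1 (initial forms).
-/

set_option linter.dupNamespace false -- mandated namespace `Summit.<Summit>.<Problem>` of this single-conjunct summit

noncomputable section

open IsLocalRing

namespace Summit.ResolutionOfSingularities.ResolutionOfSingularities.Cruxes.EquisingularLiftNat.Sections

section Constants

variable {O A κ : Type*} [CommRing O] [CommRing A] [IsLocalRing A] [IsNoetherianRing A] [CommRing κ]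
  (ρ : O →+* A) (π : A →+* κ)

/-- An element of the maximal ideal of a Noetherian local ring with `e`-th roots for every `e ≥ 1` is `0`: `a = bᵉ ∈ 𝔪` forces `b ∈ 𝔪`,
so `a ∈ 𝔪ᵉ` for every `e`, and `⋂ₑ 𝔪ᵉ = 0` (Krull). [cite: Matsumura1987, Thm. 8.10] [folklore] -/
theorem eq_zero_of_forall_pow_of_mem_maximalIdeal {a : A} (ha : ∀ e : ℕ, 0 < e → ∃ b : A, b ^ e = a) (h𝔪 : a ∈ maximalIdeal A) :
    a = 0 := by
  have hmem : a ∈ ⨅ e : ℕ, maximalIdeal A ^ e := by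
    refine Ideal.mem_iInf.mpr fun e => ?_
    rcases Nat.eq_zero_or_pos e with rfl | he
    · rw [pow_zero, Ideal.one_eq_top]; exact Submodule.mem_top
    · obtain ⟨b, rfl⟩ := ha e he
      exact Ideal.pow_mem_pow ((maximalIdeal.isMaximal A).isPrime.mem_of_pow_mem e h𝔪) e
  rwa [Ideal.iInf_pow_eq_bot_of_isLocalRing _ (maximalIdeal.isMaximal A).ne_top, Ideal.mem_bot] at hmem

variable (hπ : RingHom.ker π = maximalIdeal A) (hsurj : Function.Surjective (π.comp ρ)) (hker : ∀ r : O, π (ρ r) = 0 → ρ r = 0)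
include hπ hsurj hker

/-- **Infinitely root-divisible elements are constants (characteristic `p`).** With constants `ρ : O → A` onto the residue field
(`π ∘ ρ` onto, `ker π = 𝔪`) and forming a field (`π (ρ r) = 0 ⇒ ρ r = 0`), in a Noetherian local ring of prime characteristic `p` every
`a` with `e`-th roots for all `e ≥ 1` is a constant: `a = b^{pⁿ}`, `b ≡ ρ μ (mod 𝔪)` give `a − ρ(μ^{pⁿ}) = (b − ρ μ)^{pⁿ} ∈ 𝔪^{pⁿ}`
(additivity of Frobenius), `ρ(μ^{pⁿ}) = ρ λ` for the constant with `ρ λ ≡ a`, so `a − ρ λ ∈ ⋂ₙ 𝔪ⁿ = 0`. (The argument of the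
…NatTowerConeDefs docstring.) [cite: Matsumura1987, Thm. 8.10] [OURS · L1 W4.5b] S7; NOT a statement of the manuscript. -/
theorem exists_eq_of_forall_pow (p : ℕ) [Fact p.Prime] [CharP A p] {a : A} (ha : ∀ e : ℕ, 0 < e → ∃ b : A, b ^ e = a) :
    ∃ r : O, ρ r = a := by
  have hp : p.Prime := Fact.out
  obtain ⟨l, hl⟩ := hsurj (π a)
  refine ⟨l, ?_⟩
  have hmem : a - ρ l ∈ ⨅ n : ℕ, maximalIdeal A ^ n := by
    refine Ideal.mem_iInf.mpr fun n => ?_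
    have hn : n ≤ p ^ n := (Nat.lt_pow_self hp.one_lt).le
    obtain ⟨b, hb⟩ := ha (p ^ n) (pow_pos hp.pos n)
    obtain ⟨μ, hμ⟩ := hsurj (π b)
    have h1 : b - ρ μ ∈ maximalIdeal A := by
      rw [← hπ, RingHom.mem_ker, map_sub, sub_eq_zero]
      exact (hμ : π (ρ μ) = π b).symm
    have h2 : a - ρ (μ ^ p ^ n) = (b - ρ μ) ^ p ^ n := by rw [sub_pow_char_pow, hb, map_pow]
    have hpow : (b - ρ μ) ^ p ^ n ∈ maximalIdeal A := Ideal.pow_mem_of_mem _ h1 _ (pow_pos hp.pos n)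
    have h3 : ρ (μ ^ p ^ n) = ρ l := by
      have h0 : π (ρ (μ ^ p ^ n - l)) = 0 := by
        have ha' : ρ (μ ^ p ^ n) = a - (b - ρ μ) ^ p ^ n := by rw [← h2]; ring
        rw [map_sub, map_sub, ha', map_sub, (RingHom.mem_ker).mp (hπ ▸ hpow : (b - ρ μ) ^ p ^ n ∈ RingHom.ker π), sub_zero,
          sub_eq_zero]
        exact (hl : π (ρ l) = π a).symm
      have h4 := hker _ h0
      rwa [map_sub, sub_eq_zero] at h4
    rw [← h3, h2]
    exact Ideal.pow_le_pow_right hn (Ideal.pow_mem_pow h1 _)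
  rw [Ideal.iInf_pow_eq_bot_of_isLocalRing _ (maximalIdeal.isMaximal A).ne_top, Ideal.mem_bot, sub_eq_zero] at hmem
  exact hmem.symm

/-- A polynomial whose coefficients are infinitely root-divisible is the image of a polynomial with constant coefficients
(`exists_eq_of_forall_pow` coefficientwise). [OURS · L1 W4.5b] S7; NOT a statement of the manuscript. -/
theorem exists_map_eq_of_forall_coeff_pow (p : ℕ) [Fact p.Prime] [CharP A p] {σ : Type*} (φ : MvPolynomial σ A)
    (hφ : ∀ (α : σ →₀ ℕ) (e : ℕ), 0 < e → ∃ b : A, b ^ e = φ.coeff α) :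
    ∃ Φ : MvPolynomial σ O, MvPolynomial.map ρ Φ = φ := by
  classical
  choose r hr using fun α => exists_eq_of_forall_pow ρ π hπ hsurj hker p (hφ α)
  refine ⟨∑ α ∈ φ.support, MvPolynomial.monomial α (r α), ?_⟩
  rw [map_sum]
  conv_rhs => rw [φ.as_sum]
  refine Finset.sum_congr rfl fun α _ => ?_
  rw [MvPolynomial.map_monomial, hr]

omit [IsLocalRing A] [IsNoetherianRing A] hπ hsurj in
/-- `map (π ∘ ρ) P = 0 ⇒ map ρ P = 0` (the constants inject into the residue field). [OURS · plumbing] -/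
theorem map_eq_zero_of_map_comp_eq_zero {σ : Type*} (P : MvPolynomial σ O) (h : MvPolynomial.map (π.comp ρ) P = 0) :
    MvPolynomial.map ρ P = 0 := by
  ext α
  rw [MvPolynomial.coeff_map, MvPolynomial.coeff_zero]
  have h' := congrArg (MvPolynomial.coeff α) h
  rw [MvPolynomial.coeff_map, MvPolynomial.coeff_zero, RingHom.comp_apply] at h'
  exact hker _ h'

omit hsurj hker in
/-- A polynomial with infinitely root-divisible coefficients and a non-zero value `φ(c) ≠ 0` does not vanish modulo `𝔪`
(a root-divisible element of `𝔪` is `0`). [OURS · L1 W4.5b] S7; NOT a statement of the manuscript. -/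
theorem map_ne_zero_of_span_eval_ne_bot {σ : Type*} (c : σ → A) (φ : MvPolynomial σ A)
    (hφ : ∀ (α : σ →₀ ℕ) (e : ℕ), 0 < e → ∃ b : A, b ^ e = φ.coeff α) (hne : Ideal.span {MvPolynomial.eval c φ} ≠ ⊥) :
    MvPolynomial.map π φ ≠ 0 := by
  intro h
  apply hne
  suffices hφ0 : φ = 0 by rw [hφ0, map_zero, Ideal.span_singleton_eq_bot]
  ext α
  have h' := congrArg (MvPolynomial.coeff α) h
  rw [MvPolynomial.coeff_map, MvPolynomial.coeff_zero] at h'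
  rw [MvPolynomial.coeff_zero]
  exact eq_zero_of_forall_pow_of_mem_maximalIdeal (hφ α) (hπ ▸ (RingHom.mem_ker).mpr h')

/-- **EXACTNESS OF THE LIFTED CONE.** If `φ ∈ A[T]` has infinitely root-divisible coefficients and `(φ(c))` is a radical ideal, and
`Φ₀ ∈ O[T]` reduces modulo `𝔪` to a `ḡ` with `ḡ ∣ φ̄` and `ḡ ∈ √(φ̄)`, then `((ρ_*Φ₀)(c)) = (φ(c))`: relations modulo `𝔪` between
constant-coefficient polynomials lift exactly. [cite: ZariskiSamuel1960, Ch. VIII §1] [OURS · L1 W4.5b] S7 (vii-loc) germ identity;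
NOT a statement of the manuscript. -/
theorem span_eval_map_eq_of_reduction (p : ℕ) [Fact p.Prime] [CharP A p] {σ : Type*} (c : σ → A) (φ : MvPolynomial σ A)
    (hφ : ∀ (α : σ →₀ ℕ) (e : ℕ), 0 < e → ∃ b : A, b ^ e = φ.coeff α)
    (hrad : (Ideal.span {MvPolynomial.eval c φ}).IsRadical) (Φ₀ : MvPolynomial σ O)
    (h1 : MvPolynomial.map (π.comp ρ) Φ₀ ∣ MvPolynomial.map π φ)
    (h2 : MvPolynomial.map (π.comp ρ) Φ₀ ∈ (Ideal.span {MvPolynomial.map π φ}).radical) :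
    Ideal.span {MvPolynomial.eval c (MvPolynomial.map ρ Φ₀)} = Ideal.span {MvPolynomial.eval c φ} := by
  obtain ⟨Φ, rfl⟩ := exists_map_eq_of_forall_coeff_pow ρ π hπ hsurj hker p φ hφ
  have hΦ : MvPolynomial.map (π.comp ρ) Φ = MvPolynomial.map π (MvPolynomial.map ρ Φ) := (MvPolynomial.map_map ρ π Φ).symm
  apply le_antisymm
  · -- `ḡ^M = φ̄ ē` lifts to `(ρ_*Φ₀)^M = φ · ρ_*E`, and `(φ(c))` is radical
    obtain ⟨M, hM⟩ := h2
    obtain ⟨ebar, hē⟩ := Ideal.mem_span_singleton'.mp hM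
    obtain ⟨E, rfl⟩ := MvPolynomial.map_surjective (π.comp ρ) hsurj ebar
    have h0 : MvPolynomial.map ρ (E * Φ - Φ₀ ^ M) = 0 := by
      refine map_eq_zero_of_map_comp_eq_zero ρ π hker _ ?_
      rw [map_sub, map_mul, map_pow, hΦ, hē, sub_self]
    rw [map_sub, map_mul, map_pow, sub_eq_zero] at h0
    refine (Ideal.span_singleton_le_iff_mem _).mpr (hrad ⟨M, ?_⟩)
    rw [← map_pow, ← h0, map_mul]
    exact Ideal.mul_mem_left _ _ (Ideal.mem_span_singleton_self _)
  · -- `φ̄ = ḡ h̄` lifts to `φ = ρ_*Φ₀ · ρ_*H`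
    obtain ⟨hbar, hh⟩ := h1
    obtain ⟨H, rfl⟩ := MvPolynomial.map_surjective (π.comp ρ) hsurj hbar
    have h0 : MvPolynomial.map ρ (Φ - Φ₀ * H) = 0 := by
      refine map_eq_zero_of_map_comp_eq_zero ρ π hker _ ?_
      rw [map_sub, map_mul, hΦ, hh, sub_self]
    rw [map_sub, map_mul, sub_eq_zero] at h0
    refine (Ideal.span_singleton_le_iff_mem _).mpr (Ideal.mem_span_singleton'.mpr ⟨MvPolynomial.eval c (MvPolynomial.map ρ H), ?_⟩)
    rw [h0, map_mul, mul_comm]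

end Constants

/-! ## Over the residue field: square-free reductions divide -/

/-- Over a field, if `ḡ` is square-free and `φ̄ ∈ √(ḡ)` then `ḡ ∣ φ̄` (`(ḡ)` is a radical ideal of the factorial ring `κ[T]`).
[folklore] -/
theorem dvd_of_mem_radical_span_of_squarefree {κ : Type*} [Field κ] {σ : Type*} {g φ : MvPolynomial σ κ} (hg : Squarefree g)
    (h : φ ∈ (Ideal.span {g}).radical) : g ∣ φ := by
  obtain ⟨N, hN⟩ := h
  obtain ⟨e, he⟩ := Ideal.mem_span_singleton'.mp hN
  rcases Nat.eq_zero_or_pos N with rfl | hN0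
  · rw [pow_zero] at he
    exact (IsUnit.of_mul_eq_one e (by rw [mul_comm]; exact he)).dvd
  · exact (hg.dvd_pow_iff_dvd hN0.ne').mp ⟨e, by rw [mul_comm]; exact he.symm⟩

/-! ## Appendix (res-type-100 g12, S7 centred chain): constant-coefficient forms under a change of frame -/

section ConstantCoefficients

variable {O A κ : Type*} [CommRing O] [CommRing A] [CommRing κ] (ρ : O →+* A) (π : A →+* κ)

/-- A constant-coefficient polynomial `ρ_*Φ` with a non-zero value ideal `(ρ_*Φ(c)) ≠ 0` does not vanish modulo `𝔪` (the constants inject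
into the residue field: `π (ρ r) = 0 ⇒ ρ r = 0`). [OURS · plumbing] -/
theorem map_map_ne_zero_of_span_eval_ne_bot (hker : ∀ r : O, π (ρ r) = 0 → ρ r = 0) {σ : Type*} (c : σ → A)
    (Φ : MvPolynomial σ O) (hne : Ideal.span {MvPolynomial.eval c (MvPolynomial.map ρ Φ)} ≠ ⊥) :
    MvPolynomial.map π (MvPolynomial.map ρ Φ) ≠ 0 := by
  intro h
  apply hne
  rw [MvPolynomial.map_map] at h
  rw [map_eq_zero_of_map_comp_eq_zero ρ π hker Φ h, map_zero, Ideal.span_singleton_eq_bot]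

/-- **EXACTNESS OF THE LIFTED CONE, constant-coefficient form** (`span_eval_map_eq_of_reduction` with `φ = ρ_*Φ` given instead of
root-divisibility; no characteristic hypothesis): if `(φ(c))` is radical and `Φ₀ ∈ O[T]` reduces to a `ḡ` with `ḡ ∣ φ̄` and `ḡ ∈ √(φ̄)`,
then `((ρ_*Φ₀)(c)) = (φ(c))`. [cite: ZariskiSamuel1960, Ch. VIII §1] [OURS · L1 W4.5b] S7; NOT a statement of the manuscript. -/
theorem span_eval_map_eq_of_reduction_of_map_eq (hsurj : Function.Surjective (π.comp ρ)) (hker : ∀ r : O, π (ρ r) = 0 → ρ r = 0)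
    {σ : Type*} (c : σ → A) (Φ : MvPolynomial σ O) (φ : MvPolynomial σ A) (hΦφ : MvPolynomial.map ρ Φ = φ)
    (hrad : (Ideal.span {MvPolynomial.eval c φ}).IsRadical) (Φ₀ : MvPolynomial σ O)
    (h1 : MvPolynomial.map (π.comp ρ) Φ₀ ∣ MvPolynomial.map π φ)
    (h2 : MvPolynomial.map (π.comp ρ) Φ₀ ∈ (Ideal.span {MvPolynomial.map π φ}).radical) :
    Ideal.span {MvPolynomial.eval c (MvPolynomial.map ρ Φ₀)} = Ideal.span {MvPolynomial.eval c φ} := by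
  subst hΦφ
  have hΦ : MvPolynomial.map (π.comp ρ) Φ = MvPolynomial.map π (MvPolynomial.map ρ Φ) := (MvPolynomial.map_map ρ π Φ).symm
  apply le_antisymm
  · obtain ⟨M, hM⟩ := h2
    obtain ⟨ebar, hē⟩ := Ideal.mem_span_singleton'.mp hM
    obtain ⟨E, rfl⟩ := MvPolynomial.map_surjective (π.comp ρ) hsurj ebar
    have h0 : MvPolynomial.map ρ (E * Φ - Φ₀ ^ M) = 0 := by
      refine map_eq_zero_of_map_comp_eq_zero ρ π hker _ ?_
      rw [map_sub, map_mul, map_pow, hΦ, hē, sub_self]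
    rw [map_sub, map_mul, map_pow, sub_eq_zero] at h0
    refine (Ideal.span_singleton_le_iff_mem _).mpr (hrad ⟨M, ?_⟩)
    rw [← map_pow, ← h0, map_mul]
    exact Ideal.mul_mem_left _ _ (Ideal.mem_span_singleton_self _)
  · obtain ⟨hbar, hh⟩ := h1
    obtain ⟨H, rfl⟩ := MvPolynomial.map_surjective (π.comp ρ) hsurj hbar
    have h0 : MvPolynomial.map ρ (Φ - Φ₀ * H) = 0 := by
      refine map_eq_zero_of_map_comp_eq_zero ρ π hker _ ?_
      rw [map_sub, map_mul, hΦ, hh, sub_self]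
    rw [map_sub, map_mul, sub_eq_zero] at h0
    refine (Ideal.span_singleton_le_iff_mem _).mpr (Ideal.mem_span_singleton'.mpr ⟨MvPolynomial.eval c (MvPolynomial.map ρ H), ?_⟩)
    rw [h0, map_mul, mul_comm]

/-- **Constant-coefficient forms under an affine change of frame with constant coefficients.** If the old frame is given by LINEAR
FORMS with constant coefficients in the new one (`c̄₀ i = (ρ_*L_i)(c̄)`), then a form `φ = ρ_*Φ` of degree `d` in the old frame becomes the
constant-coefficient form `ρ_*(Φ ∘ L)` of degree `d` in the new frame, with the same value: `(ρ_*(Φ ∘ L))(c̄) = φ(c̄₀)`. [folklore] -/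
theorem isHomogeneous_and_eval_map_bind₁ {σ τ : Type*} (cb : σ → A) (cb₀ : τ → A) (L : τ → MvPolynomial σ O)
    (hL : ∀ i, (L i).IsHomogeneous 1) (hrel : ∀ i, MvPolynomial.eval cb (MvPolynomial.map ρ (L i)) = cb₀ i)
    (Φ : MvPolynomial τ O) {d : ℕ} (hφd : (MvPolynomial.map ρ Φ).IsHomogeneous d) :
    (MvPolynomial.map ρ (MvPolynomial.bind₁ L Φ)).IsHomogeneous d ∧
      MvPolynomial.eval cb (MvPolynomial.map ρ (MvPolynomial.bind₁ L Φ)) = MvPolynomial.eval cb₀ (MvPolynomial.map ρ Φ) := by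
  rw [MvPolynomial.map_bind₁]
  refine ⟨?_, ?_⟩
  · have h := hφd.aeval (fun i => MvPolynomial.map ρ (L i)) (fun i => (hL i).map ρ)
    rw [one_mul] at h
    exact h
  · change MvPolynomial.eval₂Hom (RingHom.id A) cb (MvPolynomial.bind₁ _ _) = _
    rw [MvPolynomial.eval₂Hom_bind₁]
    have hfun : (fun i => MvPolynomial.eval₂Hom (RingHom.id A) cb (MvPolynomial.map ρ (L i))) = cb₀ := funext hrel
    rw [hfun]
    rfl

end ConstantCoefficients

end Summit.ResolutionOfSingularities.ResolutionOfSingularities.Cruxes.EquisingularLiftNat.Sections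

end
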